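/-
Copyright (c) 2026 the pub-hodgecm-mathlib formalisation cell (harness21).  Prover seat hodgecm-mathlib-R90-IF-p02 (g2), programme R90-TF, section S9 «InnerForm-13.3.6 (c)»,
default offer (O-27) «`hcoverR` = positive detector + transfer pair; the transfer pair is ★ from the kit laws» (R90 bus 2026-09-04T23:46Z).
-/
import Summits.HodgeConjecture.HodgeConjecture.Theorems.R90S9InnerFormSec146Levels   -- ★ p862556 (R90-IF-p04 (g2)): `Level`, `Evp`, `gradeRep`, `IsLevelTest`; cone ★ `DatumInputs` (`X.trPrime`), ★ Scope (`RepPrimeSph`, `mPrimeSph`)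
import HarnessLib

/-!
# R90-TF · S9 «InnerForm-13.3.6 (c)» — ROW 27 `hcoverR` (the COFINAL GRADED DETECTOR WITH TRANSFERS) SPLITS: a POSITIVE DETECTOR on the level tests + «smooth transfer
# exists on `𝓕₀`»; the second is ★ from the kit laws (p862997), so the socket shrinks to the detector (Rogawski 1990 §14.6 p. 242 l. 15–16, p. 244; §14.2 p. 233 (14.2.1))

Cell `hodgecm-mathlib`, crux H413 (`stmt-HodgeConjecture-24833`, lane `--supports … --as helper`), route of record `HCCMUnconditional` (no route verbs; count-neutral).
Programme R90-TF (HUMAN RULING «R90-TF SLAB — MAX PUSH»; brief `director/R90-BRIEF.v2.md` 1f40d54518340a35), section S9 = InnerForm-13.3.6 (c) (base `R90-IF`); seat R90-IF-p02 (g2);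
default offer (O-27) posted on the R90 bus 23:46Z after the dealer's queue (a)→(J8-p)→(b) closed.  THEOREMS ONLY (no `def`, no instance, no notation, no named-fact hypothesis,
no `sorry`); imports ★ `Theorems` only (FILE B ED. 4 imports THIS file).
HONEST LABEL: HC_CM is proved only modulo the 7 printed citations (2 remaining named inputs: hLiu418 = stmt-HodgeConjecture-24832, h413 = stmt-HodgeConjecture-24833) — until
rung 0 closes.  This file proves no printed statement: it is the 10-line LOGIC that assembles the binder `hcoverR` of ★ (δ5)∕(δ6a–d) `definiteAeRigidity_*` (★
`R90S9DefiniteAeRigidityPayLineCmp` :217–:223, bytes VERBATIM at generic `X`, loose `Smooth ∕ Transfer ∕ TransferH`) from TWO inputs with DIFFERENT payers: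
* `hdet` — the POSITIVE DETECTOR (arch ∕ S2, «S′ is chosen large enough», p. 242 l. 15–16): for a spherical class `π′` with `m′ π′ ≠ 0` and a level `l₀`, a deeper level `l ⊇ l₀` grading
  `π′` and a level test `f₀` with `m′ π · tr′ π f₀ ≥ 0` for every spherical `π` and `≠ 0` at `π′` — NO transfer clause;
* `hex` — «smooth transfer exists on the test pairs `𝓕₀`» in the pay line's currency `∃ f fH, (Smooth p ∧ Transfer p f) ∧ TransferH p fH` — at B this is ★ p862997
  `R90.S9.transferPair_exists_of_kitLaws … hsm htE` (pin (iv) + T1g), IN-FILE, 0 sorry;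
noting that a level test IS a test pair of `𝓕₀` (★ `IsLevelTest` :181–:187 = `ArchTestKc ∧ (locally constant, compact support) ∧ (level off `l`) ∧ (cofinitely `𝟙_{K_v}`)`).
So B's row 27 socket SHRINKS from `sock_S9_coverR_cm` (detector + transfers; payers «S3∕S6∕arch») to `sock_S9_posDetector_cm : ‹hdet at X_cm›` (payer arch∕S2 alone).

## Contents (namespace `Summit.HodgeConjecture.HodgeConjecture.R90.S9.InnerFormSec146`, X- and Ξ-generic)
* `testPair_of_isLevelTest` — a level test is a test pair of `𝓕₀` (projection).
* **`hcoverR_of_posDetector`** — `hex → hdet → ‹hcoverR VERBATIM›`.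
B's row: `hcoverR := InnerFormSec146.hcoverR_of_posDetector _ _ _ L ι H T hT μ νG Ξ₀ 𝔩 (X_cm …) (Smooth_cm …) (Transfer_cm …) (TransferH_cm …)
  (R90.S9.transferPair_exists_of_kitLaws L ι H T hT 𝔨.Smooth 𝔨.Transfer 𝔨.TransferH (fun f′ h => (IsPinned.smooth_iff hpin f′).2 h) htE) (sock_S9_posDetector_cm …)`.

## References
[Rogawski1990] J. D. Rogawski, *Automorphic Representations of Unitary Groups in Three Variables*, Ann. of Math. Stud. 123 (1990): §14.6 p. 242 l. 10–22, Thm. 14.6.4 p. 244;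
§14.2 p. 233 (14.2.1); §13.7 p. 206.
-/

set_option autoImplicit false
set_option linter.dupNamespace false  -- the mandated namespace repeats the summit's segment (`HodgeConjecture.HodgeConjecture`)

noncomputable section

open NumberField IsDedekindDomain MeasureTheory
open scoped Matrix MatrixGroups ComplexOrder
open Literature.NumberTheory Literature.NumberTheory.Automorphic Literature.NumberTheory.Automorphic.UnitaryGroup
open Literature.NumberTheory.Rogawski1990
open Summit.HodgeConjecture.HodgeConjecture.Cruxes.H413
open Summit.HodgeConjecture.HodgeConjecture.Cruxes.H413.F0P3GlobalPacket Summit.HodgeConjecture.HodgeConjecture.Cruxes.H413.F0P3LocalPacketKit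

namespace Summit.HodgeConjecture.HodgeConjecture.R90.S9.InnerFormSec146

section CoverR

variable (TG' TG TH : Type) (L : Type) [Field L] [NumberField L] [IsCMField L] (ι : L →+* ℂ) (H : Matrix (Fin 3) (Fin 3) L) (T : GL (Fin 3) ℂ)
  (hT : (T : Matrix (Fin 3) (Fin 3) ℂ)ᴴ * H.map ι * (T : Matrix (Fin 3) (Fin 3) ℂ) = Literature.Geometry.ComplexHyperbolic.BallModel.J)
  (μA : Measure (adelicGroupData (↥(maximalRealSubfield L)) L (IsCMField.complexConj L) 3 H).automorphicQuotient)
  [(adelicGroupData (↥(maximalRealSubfield L)) L (IsCMField.complexConj L) 3 H).IsAutomorphicMeasure μA]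
  (μv : ∀ v : HeightOneSpectrum (𝓞 ↥(maximalRealSubfield L)), @Measure ((cmDatum L 3 H).Local v) (borel _))
  (Ξ : OneDimAutRepH L → PacketPrimeFin L H) {H' : Matrix (Fin 3) (Fin 3) L}
  (𝔩 : ∀ v : HeightOneSpectrum (𝓞 ↥(maximalRealSubfield L)), LocalPacketKit L H' v)
  (X : DatumInputs ((UnitaryGroup.arch (↥(maximalRealSubfield L)) L (IsCMField.complexConj L) 3 H → ℂ) ×
    (∀ v : HeightOneSpectrum (𝓞 ↥(maximalRealSubfield L)), (cmDatum L 3 H).Local v → ℂ)) TG TH L ι H T hT μA Ξ 𝔩)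
  -- the pay line's loose transfer predicates on the PAIR test type (B: `Smooth_cm …`, `Transfer_cm …`, `TransferH_cm …`)
  (Smooth : ((UnitaryGroup.arch (↥(maximalRealSubfield L)) L (IsCMField.complexConj L) 3 H → ℂ) ×
    (∀ v : HeightOneSpectrum (𝓞 ↥(maximalRealSubfield L)), (cmDatum L 3 H).Local v → ℂ)) → Prop)
  (Transfer : ((UnitaryGroup.arch (↥(maximalRealSubfield L)) L (IsCMField.complexConj L) 3 H → ℂ) ×
    (∀ v : HeightOneSpectrum (𝓞 ↥(maximalRealSubfield L)), (cmDatum L 3 H).Local v → ℂ)) → TG → Prop)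
  (TransferH : ((UnitaryGroup.arch (↥(maximalRealSubfield L)) L (IsCMField.complexConj L) 3 H → ℂ) ×
    (∀ v : HeightOneSpectrum (𝓞 ↥(maximalRealSubfield L)), (cmDatum L 3 H).Local v → ℂ)) → TH → Prop)

/-- **A level test is a test pair of `𝓕₀`** — the guard of ★ `Smooth_cm` ∕ the hypothesis of ★ `transferPair_exists_of_kitLaws` (conjuncts 1, 2, 4 of ★ `IsLevelTest`).
[cite: Rogawski1990, §14.6 p. 242 l. 10; §14.2 p. 233] -/
theorem testPair_of_isLevelTest (l : Level L)
    (p : (UnitaryGroup.arch (↥(maximalRealSubfield L)) L (IsCMField.complexConj L) 3 H → ℂ) ×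
      (∀ v : HeightOneSpectrum (𝓞 ↥(maximalRealSubfield L)), (cmDatum L 3 H).Local v → ℂ))
    (h : IsLevelTest L ι H T hT l p) :
    ArchTestKc L ι H T hT p.1 ∧ (∀ v : HeightOneSpectrum (𝓞 ↥(maximalRealSubfield L)), IsLocallyConstant (p.2 v) ∧ HasCompactSupport (p.2 v)) ∧
      {v : HeightOneSpectrum (𝓞 ↥(maximalRealSubfield L)) |
        p.2 v ≠ (cmLocalIntegralLevel L 3 H v : Set ((cmDatum L 3 H).Local v)).indicator fun _ => (1 : ℂ)}.Finite :=
  ⟨h.1, h.2.1, h.2.2.2⟩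

/-- **ROW 27 `hcoverR` FROM A POSITIVE DETECTOR AND TRANSFER EXISTENCE ON `𝓕₀`** (the binder of ★ (δ6a–d) `definiteAeRigidity_*` ∕ ★ `…PayLineCmp` :217–:223 VERBATIM at
generic `X`): for every spherical `π′` with `m′ π′ ≠ 0` and level `l₀`, the detector `hdet` supplies `l ⊇ l₀`, a grade `e` of `π′` at `l` and a level test `f₀` with all
`m′ π · tr′ π f₀ ≥ 0` and `m′ π′ · tr′ π′ f₀ ≠ 0`; `hex` (★ p862997 at B) supplies `f`, `f^H` with `(Smooth f₀ ∧ Transfer f₀ f) ∧ TransferH f₀ f^H`, `f₀` being a test pair of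
`𝓕₀`. [cite: Rogawski1990, §14.6 p. 242 l. 15–16, Thm. 14.6.4 p. 244; §14.2 p. 233 (14.2.1)] -/
theorem hcoverR_of_posDetector
    (hex : ∀ p : (UnitaryGroup.arch (↥(maximalRealSubfield L)) L (IsCMField.complexConj L) 3 H → ℂ) ×
        (∀ v : HeightOneSpectrum (𝓞 ↥(maximalRealSubfield L)), (cmDatum L 3 H).Local v → ℂ),
      (ArchTestKc L ι H T hT p.1 ∧ (∀ v : HeightOneSpectrum (𝓞 ↥(maximalRealSubfield L)), IsLocallyConstant (p.2 v) ∧ HasCompactSupport (p.2 v)) ∧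
        {v : HeightOneSpectrum (𝓞 ↥(maximalRealSubfield L)) |
          p.2 v ≠ (cmLocalIntegralLevel L 3 H v : Set ((cmDatum L 3 H).Local v)).indicator fun _ => (1 : ℂ)}.Finite) →
      ∃ (f : TG) (fH : TH), (Smooth p ∧ Transfer p f) ∧ TransferH p fH)
    (hdet : ∀ π' : RepPrimeSph L ι H T hT μA, mPrimeSph L ι H T hT μA π' ≠ 0 → ∀ l₀ : Level L,
      ∃ l : Level L, l₀ ⊆ l ∧ ∃ (e : Evp L H) (f₀ : (UnitaryGroup.arch (↥(maximalRealSubfield L)) L (IsCMField.complexConj L) 3 H → ℂ) ×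
        (∀ v : HeightOneSpectrum (𝓞 ↥(maximalRealSubfield L)), (cmDatum L 3 H).Local v → ℂ)),
        gradeRep L ι H T hT μA μv l π' = some e ∧ IsLevelTest L ι H T hT l f₀ ∧
          (∀ π : RepPrimeSph L ι H T hT μA, 0 ≤ (mPrimeSph L ι H T hT μA π : ℂ) * X.trPrime π f₀) ∧ (mPrimeSph L ι H T hT μA π' : ℂ) * X.trPrime π' f₀ ≠ 0) :
    ∀ π' : RepPrimeSph L ι H T hT μA, mPrimeSph L ι H T hT μA π' ≠ 0 → ∀ l₀ : Level L,
      ∃ l : Level L, l₀ ⊆ l ∧ ∃ (e : Evp L H) (f₀ : (UnitaryGroup.arch (↥(maximalRealSubfield L)) L (IsCMField.complexConj L) 3 H → ℂ) ×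
        (∀ v : HeightOneSpectrum (𝓞 ↥(maximalRealSubfield L)), (cmDatum L 3 H).Local v → ℂ)) (f : TG) (fH : TH),
        gradeRep L ι H T hT μA μv l π' = some e ∧ IsLevelTest L ι H T hT l f₀ ∧ (Smooth f₀ ∧ Transfer f₀ f) ∧ TransferH f₀ fH ∧
          (∀ π : RepPrimeSph L ι H T hT μA, 0 ≤ (mPrimeSph L ι H T hT μA π : ℂ) * X.trPrime π f₀) ∧ (mPrimeSph L ι H T hT μA π' : ℂ) * X.trPrime π' f₀ ≠ 0 := by
  intro π' hm l₀
  obtain ⟨l, hl, e, f₀, hg, hlt, hpos, hne⟩ := hdet π' hm l₀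
  obtain ⟨f, fH, hTr, hTrH⟩ := hex f₀ (testPair_of_isLevelTest L ι H T hT l f₀ hlt)
  exact ⟨l, hl, e, f₀, f, fH, hg, hlt, hTr, hTrH, hpos, hne⟩

end CoverR

end Summit.HodgeConjecture.HodgeConjecture.R90.S9.InnerFormSec146

end
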